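import Literature.AlgebraicGeometry.Frobenioids.PadicFrobenioidTwistToolkit
import HarnessLib

/-!
# Frobenioids II, Remark 1.2.2, sentence 4 under reading (R1): the automorphism `U` (proof)

Mochizuki, *The geometry of Frobenioids II*, Kyushu J. Math. **62** (2008), §1, Remark 1.2.2, p. 10
[cite: MochizukiFrdII2008, Rmk 1.2.2 p.10]: "one obtains a unique automorphism `U` of the data
`(Φ, B → Φ^gp)` which is the identity on `O^×(−)` … and `Φ`, but which maps `τ` … to `u_D · τ`."

PROOF-ONLY companion (abc-iut node `FrdII:Rmk1.2.2-R1`): discharge of abc-iut-L1-t4's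
`Datum.Rmk122UOfBijective` (`PadicFrobenioidRmk122.lean`). For an absolutely primitive datum with bijective
pull-backs on `Φ`, a section `u_D` of `O^×(−)` and a characteristic splitting `τ`:

* EXISTENCE: `Φ(A) ≅ ℤ_{≥0}` with generator `g_A` (`exists_generator_Φ`); every `b ∈ B(A)` has
  `Div_B(b) = g_A^{m_A(b)}` for a unique `m_A(b) ∈ ℤ`; `U := (id_Φ, β)`, `β_A(b) := b · u_A^{m_A(b)}`. It fixes
  `Ker(Div_B) = O^×(−)` (`m = 0` there) and maps the rational function `u_η` of a generator `η` of `τ(X)` to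
  `u_η · u_A` (`Div(η) = g_A`, so `m(u_η) = 1`); `β` is natural because bijective pull-backs carry generators
  to generators, and objectwise bijective.
* UNIQUENESS: `B(A) = O^×(A) · u_η^ℤ` (`Div_B` has values in `g_A^ℤ`), so ANY `U' = (id, β')` fixing `O^×(−)`
  with `β'(u_η) = u_η · u_A` is given by the same formula.
-/

namespace Literature.AlgebraicGeometry.Frobenioids

namespace PadicFrd

open CategoryTheory Opposite Function

universe v u

namespace Datum

variable {D : Type u} [Category.{v} D] {p : ℕ} [Fact p.Prime] (d : Datum D p)

/-- A monoid homomorphism into a group commutes with integer powers of units. [folklore] -/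
private theorem map_units_zpow' {M G : Type*} [Monoid M] [Group G] (f : M →* G) (c : Mˣ) (k : ℤ) :
    f ((c ^ k : Mˣ) : M) = f (c : M) ^ k := by
  rw [← Units.coe_map, map_zpow, Units.val_zpow_eq_zpow_val, Units.coe_map]

/-- A monoid homomorphism `M → M` on integer powers of units. [folklore] -/
private theorem map_units_zpow_eq {M : Type*} [Monoid M] (f : M →* M) (c : Mˣ) (k : ℤ) :
    f ((c ^ k : Mˣ) : M) = ((Units.map f c ^ k : Mˣ) : M) := by
  rw [← Units.coe_map, map_zpow]

/-- **Remark 1.2.2, sentence 4 under reading (R1) — PROVED**: for an absolutely primitive datum whose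
pull-back maps on `Φ` are bijective, a section `u_D` of `O^×(−)` and a characteristic splitting `τ` on `C`,
there is a UNIQUE automorphism `U = (id_Φ, β)` of the data `(Φ, B → Φ^gp)` fixing `O^×(−)` pointwise and
sending the rational function of each generator `η` of `τ(X)` to `u_η · u_{A_D}`; explicitly
`β_A(b) = b · u_A^{m_A(b)}` with `Div_B(b) = g_A^{m_A(b)}`, `g_A` the generator of `Φ(A) ≅ ℤ_{≥0}`.
[cite: MochizukiFrdII2008, Rmk 1.2.2 p.10] -/
theorem rmk122UOfBijective_holds : d.Rmk122UOfBijective := by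
  intro hbij hap s T
  classical
  -- generators `g_A` of `Φ(A) ≅ ℤ_{≥0}`
  choose g hg1 hgen hginj using fun A => d.exists_generator_Φ hap A
  have huniq : ∀ (A : D) (g' : d.Φ.obj (op A)), (∀ x, ∃ k : ℕ, x = g' ^ k) → g' = g A := fun A g' hg' => by
    obtain ⟨a, ha⟩ := hg' (g A)
    obtain ⟨b, hb⟩ := hgen A g'
    have hab : g A ^ 1 = g A ^ (b * a) := by rw [pow_one, pow_mul, ← hb, ← ha]
    have hb1 : b = 1 := Nat.eq_one_of_mul_eq_one_right (hginj A _ _ hab).symm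
    rw [hb, hb1, pow_one]
  -- bijective pull-backs carry generators to generators
  have hgmap : ∀ {A A' : D} (f : A ⟶ A'), (d.Φ.map f.op).hom (g A') = g A := fun {A A'} f =>
    huniq A _ fun x => by
      obtain ⟨y, rfl⟩ := (hbij f).2 x
      obtain ⟨k, rfl⟩ := hgen A' y
      exact ⟨k, map_pow _ _ _⟩
  -- the divisor of a generator of `τ(X)` is `g`
  have hdivη : ∀ (X : d.frobenioid) (η : End X), IsGeneratorOf η (T.τ X) →
      Frobenioids.divB d.Φ d.B d.divB (op X.base) (ModelFrobenioid.unit (End.asHom η)) =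
        Algebra.GrothendieckGroup.of (g X.base) := fun X η hη => by
    rw [← d.of_div_eq_divB_unit (d.τ_le' T X hη.1), huniq X.base _ (d.div_isGenerator_of_isGeneratorOf T hap hη).1]
  -- `Φ^gp(A) = g_A^ℤ`, with injective exponent
  have hzinj : ∀ A : D, Injective fun k : ℤ => Algebra.GrothendieckGroup.of (g A) ^ k := fun A => by
    haveI := (d.isMonoprime (op A)).isCancelMul
    rw [injective_zpow_iff_not_isOfFinOrder, isOfFinOrder_iff_pow_eq_one]
    rintro ⟨N, hN, h⟩
    rw [← map_pow] at h
    have h1 : g A ^ N = g A ^ 0 := by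
      rw [pow_zero]
      exact Algebra.GrothendieckGroup.of_injective (h.trans (map_one _).symm)
    exact absurd (hginj A _ _ h1) hN.ne'
  have hex : ∀ (A : D) (b : d.B.obj (op A)), ∃ m : ℤ,
      Frobenioids.divB d.Φ d.B d.divB (op A) b = Algebra.GrothendieckGroup.of (g A) ^ m := fun A b => by
    obtain ⟨a, c, hac⟩ := grothendieckGroup_exists_mul_of_eq_of (Frobenioids.divB d.Φ d.B d.divB (op A) b)
    obtain ⟨i, hi⟩ := hgen A a
    obtain ⟨j, hj⟩ := hgen A c
    refine ⟨(i : ℤ) - j, ?_⟩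
    rw [zpow_sub, zpow_natCast, zpow_natCast, ← map_pow, ← map_pow, ← hi, ← hj]
    exact eq_mul_inv_of_mul_eq hac
  choose m hm using hex
  have hm_eq : ∀ (A : D) (b : d.B.obj (op A)) (k : ℤ),
      Frobenioids.divB d.Φ d.B d.divB (op A) b = Algebra.GrothendieckGroup.of (g A) ^ k → m A b = k :=
    fun A b k h => hzinj A ((hm A b).symm.trans h)
  have hm_mul : ∀ (A : D) (b c : d.B.obj (op A)), m A (b * c) = m A b + m A c := fun A b c =>
    hm_eq A _ _ (by rw [map_mul, hm, hm, zpow_add])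
  have hm_one : ∀ A : D, m A 1 = 0 := fun A => hm_eq A _ _ (by rw [map_one, zpow_zero])
  have hm_ker : ∀ (A : D) (b : d.B.obj (op A)), Frobenioids.divB d.Φ d.B d.divB (op A) b = 1 → m A b = 0 :=
    fun A b hb => hm_eq A _ _ (by rw [hb, zpow_zero])
  have hm_nat : ∀ {A A' : D} (f : A ⟶ A') (b : d.B.obj (op A')), m A ((d.B.map f.op).hom b) = m A' b :=
    fun {A A'} f b => hm_eq A _ _ (by rw [← pullGp_divB, hm, map_zpow, pullGp_of, hgmap])
  -- the section as units `cu_A` of `B(A)`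
  obtain ⟨cu, hcu⟩ : ∃ cu : ∀ A : D, (d.B.obj (op A))ˣ, ∀ A, (cu A : d.B.obj (op A)) = s.u A :=
    ⟨fun A => (d.isUnit_B (op A) (s.u A)).unit, fun A => IsUnit.unit_spec _⟩
  have hcu_div : ∀ (A : D) (k : ℤ),
      Frobenioids.divB d.Φ d.B d.divB (op A) ((cu A ^ k : (d.B.obj (op A))ˣ) : d.B.obj (op A)) = 1 := fun A k => by
    rw [map_units_zpow', hcu, s.divB_u, one_zpow]
  have hm_cu : ∀ (A : D) (k : ℤ), m A ((cu A ^ k : (d.B.obj (op A))ˣ) : d.B.obj (op A)) = 0 := fun A k =>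
    hm_ker A _ (hcu_div A k)
  have hcu_map : ∀ {A A' : D} (f : A ⟶ A') (k : ℤ),
      (d.B.map f.op).hom ((cu A' ^ k : (d.B.obj (op A'))ˣ) : d.B.obj (op A')) = (cu A ^ k : (d.B.obj (op A))ˣ) :=
    fun {A A'} f k => by
    have h : Units.map (d.B.map f.op).hom (cu A') = cu A := Units.ext (by rw [Units.coe_map, hcu, hcu, s.map_u])
    rw [← Units.coe_map, map_zpow, h]
  -- `η` a generator of `τ(X)`: its rational function as a unit `cη` of `B(A)`, and `m(u_η) = 1`
  have hmη : ∀ (X : d.frobenioid) (η : End X), IsGeneratorOf η (T.τ X) →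
      m X.base (ModelFrobenioid.unit (End.asHom η)) = 1 := fun X η hη =>
    hm_eq _ _ _ (by rw [hdivη X η hη, zpow_one])
  -- ANY `V` fixing `O^×(−)` and mapping `τ` to `u_D · τ` is given by the formula `b ↦ b · u_A^{m_A(b)}`
  have hdet : ∀ V : ModelFrobenioid.DataHom d.divB d.divB, d.FixesUnits V → d.MapsSplittingTo V s T.τ →
      ∀ (A : D) (b : d.B.obj (op A)),
        (V.β.app (op A)).hom b = b * ((cu A ^ m A b : (d.B.obj (op A))ˣ) : d.B.obj (op A)) := by
    intro V hfix hmaps A b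
    let X : d.frobenioid := ModelFrobenioid.zeroObj d.Φ d.B d.divB A
    obtain ⟨η, hη⟩ := d.exists_isGeneratorOf_τ T hap X
    obtain ⟨cη, hcη⟩ := d.isUnit_B (op A) (ModelFrobenioid.unit (End.asHom η))
    have hVη : Units.map (V.β.app (op A)).hom cη = cη * cu A := Units.ext (by
      rw [Units.coe_map, Units.val_mul, hcη, hcu]
      exact hmaps X η hη)
    -- `w := b · u_η^{-m(b)} ∈ Ker(Div_B)`
    have hw : Frobenioids.divB d.Φ d.B d.divB (op A)
        (b * ((cη ^ (-(m A b)) : (d.B.obj (op A))ˣ) : d.B.obj (op A))) = 1 := by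
      rw [map_mul, map_units_zpow', hcη, hm A b]
      change _ * Frobenioids.divB d.Φ d.B d.divB (op X.base) (ModelFrobenioid.unit (End.asHom η)) ^ (-(m A b)) = 1
      rw [hdivη X η hη, ← zpow_add, add_neg_cancel, zpow_zero]
    have hb : b = b * ((cη ^ (-(m A b)) : (d.B.obj (op A))ˣ) : d.B.obj (op A)) *
        ((cη ^ m A b : (d.B.obj (op A))ˣ) : d.B.obj (op A)) := by
      rw [mul_assoc, ← Units.val_mul, ← zpow_add, neg_add_cancel, zpow_zero, Units.val_one, mul_one]
    conv_lhs => rw [hb]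
    rw [map_mul, hfix (op A) _ hw, map_units_zpow_eq, hVη, mul_zpow, Units.val_mul, ← mul_assoc, ← hb]
  -- EXISTENCE: the twist `U = (id_Φ, β)`, `β_A(b) = b · u_A^{m_A(b)}`
  let βA : ∀ A : Dᵒᵖ, d.B.obj A →* d.B.obj A := fun A =>
    { toFun := fun b => b * ((cu A.unop ^ m A.unop b : (d.B.obj A)ˣ) : d.B.obj A)
      map_one' := by rw [hm_one, zpow_zero, Units.val_one, mul_one]
      map_mul' := fun b c => by rw [hm_mul, zpow_add, Units.val_mul, mul_mul_mul_comm] }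
  have hβA : ∀ (A : Dᵒᵖ) (b : d.B.obj A),
      βA A b = b * ((cu A.unop ^ m A.unop b : (d.B.obj A)ˣ) : d.B.obj A) := fun A b => rfl
  let β : d.B ⟶ d.B :=
    { app := fun A => CommMonCat.ofHom (βA A)
      naturality := fun A A' f => by
        obtain ⟨A⟩ := A
        obtain ⟨A'⟩ := A'
        apply CommMonCat.hom_ext
        apply MonoidHom.ext
        intro b
        change βA (op A') ((d.B.map f).hom b) = (d.B.map f).hom (βA (op A) b)
        have e1 : m A' ((d.B.map f).hom b) = m A b := hm_nat f.unop b
        have e2 : ∀ k : ℤ, (d.B.map f).hom ((cu A ^ k : (d.B.obj (op A))ˣ) : d.B.obj (op A)) =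
            (cu A' ^ k : (d.B.obj (op A'))ˣ) := fun k => hcu_map f.unop k
        rw [hβA, hβA, map_mul]
        dsimp only [Opposite.unop_op]
        rw [e2, e1] }
  have hcomm : ∀ (A : Dᵒᵖ) (b : d.B.obj A),
      gpApp (𝟙 d.Φ) A (Frobenioids.divB d.Φ d.B d.divB A b) =
        Frobenioids.divB d.Φ d.B d.divB A ((β.app A).hom b) := fun A b => by
    obtain ⟨A⟩ := A
    change MonGp.map (MonoidHom.id _) (Frobenioids.divB d.Φ d.B d.divB (op A) b) =
      Frobenioids.divB d.Φ d.B d.divB (op A) (βA (op A) b)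
    rw [MonGp.map_id, MonoidHom.id_apply, hβA, map_mul]
    change _ = _ * Frobenioids.divB d.Φ d.B d.divB (op A) ((cu A ^ m A b : (d.B.obj (op A))ˣ) : d.B.obj (op A))
    rw [hcu_div, mul_one]
  have hbijβ : ∀ A : D, Bijective (βA (op A)) := fun A => by
    constructor
    · intro b c h
      rw [hβA, hβA] at h
      change b * ((cu A ^ m A b : (d.B.obj (op A))ˣ) : d.B.obj (op A)) =
        c * ((cu A ^ m A c : (d.B.obj (op A))ˣ) : d.B.obj (op A)) at h
      have he : m A b = m A c := by
        have h' := congrArg (m A) h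
        rwa [hm_mul, hm_mul, hm_cu, hm_cu, add_zero, add_zero] at h'
      rw [he] at h
      exact (Units.mul_left_inj _).mp h
    · intro c
      refine ⟨c * ((cu A ^ (-(m A c)) : (d.B.obj (op A))ˣ) : d.B.obj (op A)), ?_⟩
      rw [hβA]
      change c * ((cu A ^ (-(m A c)) : (d.B.obj (op A))ˣ) : d.B.obj (op A)) *
          ((cu A ^ m A (c * ((cu A ^ (-(m A c)) : (d.B.obj (op A))ˣ) : d.B.obj (op A))) :
            (d.B.obj (op A))ˣ) : d.B.obj (op A)) = c
      rw [hm_mul, hm_cu, add_zero, mul_assoc, ← Units.val_mul, ← zpow_add, neg_add_cancel, zpow_zero,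
        Units.val_one, mul_one]
  refine ⟨⟨𝟙 d.Φ, β, hcomm⟩, ⟨⟨rfl, fun A => by obtain ⟨A⟩ := A; exact hbijβ A⟩, ?_, ?_⟩, ?_⟩
  · -- `U` fixes `O^×(−) = Ker(Div_B)`
    intro A b hb
    obtain ⟨A⟩ := A
    change βA (op A) b = b
    rw [hβA]
    change b * ((cu A ^ m A b : (d.B.obj (op A))ˣ) : d.B.obj (op A)) = b
    rw [hm_ker A b hb, zpow_zero, Units.val_one, mul_one]
  · -- `U` maps `τ` to `u_D · τ`
    intro X η hη
    change βA (op X.base) (ModelFrobenioid.unit (End.asHom η)) = _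
    rw [hβA]
    change ModelFrobenioid.unit (End.asHom η) *
      ((cu X.base ^ m X.base (ModelFrobenioid.unit (End.asHom η)) : (d.B.obj (op X.base))ˣ) : d.B.obj (op X.base)) = _
    rw [hmη X η hη, zpow_one, hcu]
  · -- UNIQUENESS
    rintro ⟨η', β', comm'⟩ ⟨hU', hfix', hmaps'⟩
    have hη' : η' = 𝟙 d.Φ := hU'.η_eq
    have hβ' : β' = β := by
      refine NatTrans.ext (funext fun A => ?_)
      obtain ⟨A⟩ := A
      apply CommMonCat.hom_ext
      apply MonoidHom.ext
      intro b
      change (β'.app (op A)).hom b = βA (op A) b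
      rw [hβA]
      exact hdet ⟨η', β', comm'⟩ hfix' hmaps' A b
    subst hη' hβ'
    rfl

end Datum

end PadicFrd

end Literature.AlgebraicGeometry.Frobenioids
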